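import Summits.BirchSwinnertonDyer.BirchSwinnertonDyer.Theorems.Rank1ResidualJetSwapLevelRaisingLiterature
import Summits.BirchSwinnertonDyer.BirchSwinnertonDyer.Theorems.ErratumRoadFiveNonSurjCornerKolyJSwapLevelRaisingPair
import Summits.BirchSwinnertonDyer.BirchSwinnertonDyer.Theorems.ClassRecordThreeCornerAtThreeUpperWalkHlevOfSelmerSupply
import Summits.BirchSwinnertonDyer.BirchSwinnertonDyer.Theorems.ClassRecordThreeCornerAtThreeUpperSelmerSupply
import Summits.BirchSwinnertonDyer.BirchSwinnertonDyer.Theorems.ClassRecordThreeShimuraKolyvaginMinusOneSquare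
import Summits.BirchSwinnertonDyer.BirchSwinnertonDyer.Theorems.ErratumRoadFiveNonSurjCornerKolyJRedefinitionSharp
import Summits.BirchSwinnertonDyer.BirchSwinnertonDyer.Theorems.KatoDescentPotSupersingularWildJetchevBoundAtPHeegnerE0ImageFree
import HarnessLib

/-!
# Route `ClassRecordThree` (rung K2@3), crux `CornerAtThree` (item 19111), Upper kit stub `stub_upper3_jetchevMax` — DISPLAY: the stub ⟸
# {the (γ)-pair congruence `Prop44.prop37_2_reductionCongruence_pair` (Gross 3.7 (2) pair form incl. ℓ = 2), Poitou–Tate for Selmer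
# structures, Gross 1991 §6 ∕ [GZ86 III (3.1)] image-free} — NO supply hypothesis, `−1 ∈ ρ̄_{E,3}(Γ_ℚ)` AUTOMATIC
# (cell `bsd-stepL`, seat `bsd-stepL-corner-p1` g11; `--supports stmt-BirchSwinnertonDyer-19111`)

WHY/WHAT. The (T4″)@3 twin of `…KolyJSwapNamedFacts` (19947, p ∈ {5,7}). (1) `Swap.levelRaising_of_pair_of_irreducible` — Kolyvagin's prime
swap on an irreducible row for ANY odd `p` from {Poitou–Tate, image-free GZ III (3.1), the (γ)-pair congruence at `(W, K)`}, through bricks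
2a (irr) ∕ 2b + 4 (pair-keyed). (2) `cornerUpper3_jetchevMax_of_namedFacts` — the registered signature of 19111's `stub_upper3_jetchevMax`
VERBATIM from `h372p` (the def `Prop44.prop37_2_reductionCongruence_pair` at every frame — Gross 1991 Prop. 3.7 (2) in pair form; at the
prime step `ℓ = 2`, possible at `p = 3` when `M = 0`, this is STRONGER than Nekovář's ∕ Gross's print and is displayed as such instead of
the Literature fact `GrossLMS1991.prop37_2_frobeniusCongruence`), `hPT`, `hF1` ONLY: g8's `cornerUpper3_jetchevMax_of_swap_of_perLevel'`
(stub ⟸ hswap + hlev) with hswap := (1) at `p = 3` (`−1 ∈ ρ̄_{E,3}(Γ_ℚ)` from shim3b `exists_sq_smul_eq_neg_three_of_irr`, disjointness prime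
from `exists_prime_dvd_discr_of_heegner`) and hlev := `hlevThree_of_pair_of_selmerSupply` ∘ `selmerSupplyCornerThree_of_poitouTate_Gross1991`.
HONEST FRAMING: CONDITIONAL (two published typed facts + one def STRONGER than print at ℓ = 2); no definition ∕ fact ∕ sorry; the stub is NOT
discharged; no item closes; nothing about any curve's BSD; BSD is not advanced; T7.
References: [cite: Jetchev2008, Thm. 1.4 (p. 812)] [cite: McCallumLMS1991, §4 Prop. 4.4, §5 Prop. 5.2] [cite: GrossLMS1991, Prop. 3.7 (2), §6 Prop. 6.2 (1)]
[cite: Nekovar2007, Prop. 4.13 (ii), (4.3)] [cite: GrossZagier1986, III (3.1)] [cite: MilneADT2006, Ch. I, Thm. 4.10(b)].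
-/

set_option autoImplicit false

noncomputable section

open scoped Classical Pointwise
open Function NumberField IsDedekindDomain WeierstrassCurve Field
open Literature.NumberTheory.EllipticCurves Literature.NumberTheory.GaloisRepresentations
open Literature.NumberTheory.EllipticCurves.Jetchev2008 Literature.NumberTheory.EllipticCurves.KolyvaginCocycle
open Literature.NumberTheory.EllipticCurves.ModularForms
open Literature.NumberTheory.GaloisCohomology Literature.NumberTheory.Automorphic
open Literature.NumberTheory.GaloisRepresentations.DiscreteGaloisModule (transverseSubgroup SelmerStructure)
open Summit.BirchSwinnertonDyer.Rank1Residual.JET.SelmerVocabulary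
open Summit.BirchSwinnertonDyer.Rank1Residual.JET.GlobalDuality
open Summit.BirchSwinnertonDyer.Rank1Residual.X11b
open Summit.BirchSwinnertonDyer.Rank1Residual.X11b.Three
open Summit.BirchSwinnertonDyer.BirchSwinnertonDyer.Theorems

open Summit.BirchSwinnertonDyer.BirchSwinnertonDyer.Theorems.HeegnerE0ImageFree
open Summit.BirchSwinnertonDyer.Rank1Residual.X11b.Three.Koly

namespace Summit.BirchSwinnertonDyer.Rank1Residual.JET.Swap

set_option maxHeartbeats 800000 in
/-- **LEVEL RAISING AT MINIMAL DEPTH on an irreducible row, ANY odd `p`, from {Poitou–Tate, image-free [GZ86 III (3.1)], the (γ)-pair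
congruence at `(W, K)`}** — bsd-jet's `levelRaising_of_literature` with `¬CM`∕tower ↦ `E[p]` irreducible, `p` split in `K`, `−1 ∈ ρ̄(Γ_ℚ)`, a
disjointness prime `q₀ ∣ d_K`, and McCallum 4.4 from `Prop44.prop37_2_reductionCongruence_pair W K`. [cite: McCallumLMS1991, §5 Prop. 5.2 (p. 304)]
[cite: Jetchev2008, Lemma 5.1, Lemma 5.2 (iii)] [cite: GrossZagier1986, III (3.1)] -/
theorem levelRaising_of_pair_of_irreducible
    (hPT : ∀ (K : Type) [Field K] [NumberField K], poitouTate_selmerStructure_duality_conj K)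
    (hF1 : Gross1991_heegnerPoint_sub_ratTorsion_mem_E0_imageFree)
    :
    ∀ (W : WeierstrassCurve ℚ) [W.IsElliptic] [W.IsGloballyMinimal] [NeZero (W.conductorNorm ℤ)]
      (K : Type) [Field K] [NumberField K], IsImaginaryQuadratic K →
      NumberField.discr K ≠ -3 → NumberField.discr K ≠ -4 →
      SatisfiesHeegnerHypothesis (W.conductorNorm ℤ) K →
      Prop44.prop37_2_reductionCongruence_pair W K →
      ∀ (p : ℕ) [Fact p.Prime], p ≠ 2 → W.HasIrreducibleModPGaloisRep p → SatisfiesHeegnerHypothesis p K →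
      (∃ γ : Field.absoluteGaloisGroup ℚ, ∀ P : geomTorsion W p, γ • P = -P) →
      ∀ {q₀ : ℕ}, q₀.Prime → (q₀ : ℤ) ∣ NumberField.discr K → ¬ q₀ ∣ W.conductorNorm ℤ → q₀ ≠ p →
      ∀ (Dt : ModularParametrizationData W (W.conductorNorm ℤ)) (β : ℤ) (ι : K →+* ℂ) (u : ℕ),
      (∀ (c : ℕ), Squarefree c →
        (∀ q ∈ c.primeFactors, Zhang2014.IsKolyvaginPrime (W.conductorNorm ℤ) W K p q ∧
          1 + u ≤ Zhang2014.kolyvaginIndex W p q) →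
        ∀ dc : KolyvaginHeegnerData Dt β ι c,
        ∃ Q : (W.baseChange (ringClassField K ι c)).toAffine.Point,
          ((p ^ u : ℕ) : ℤ) • Q = dc.derivedPoint) →
      ∀ (n₀ : ℕ), Squarefree n₀ →
        (∀ q ∈ n₀.primeFactors, Zhang2014.IsKolyvaginPrime (W.conductorNorm ℤ) W K p q ∧
          1 + u ≤ Zhang2014.kolyvaginIndex W p q) →
        ∀ d₀ : KolyvaginHeegnerData Dt β ι n₀,
        (¬ ∃ Q : (W.baseChange (ringClassField K ι n₀)).toAffine.Point,
          ((p ^ (u + 1) : ℕ) : ℤ) • Q = d₀.derivedPoint) →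
        ∀ m' : ℕ, ∃ (n : ℕ) (d : KolyvaginHeegnerData Dt β ι n), Squarefree n ∧
          (∀ q ∈ n.primeFactors, Zhang2014.IsKolyvaginPrime (W.conductorNorm ℤ) W K p q ∧
            max m' (1 + u) ≤ Zhang2014.kolyvaginIndex W p q) ∧
          ¬ ∃ Q : (W.baseChange (ringClassField K ι n)).toAffine.Point,
            ((p ^ (u + 1) : ℕ) : ℤ) • Q = d.derivedPoint := by
  intro W _ _ _ K _ _ hK hD3 hD4 hH h372p p _ hp2 hirr hHp hneg q₀ hq₀ hq₀d hq₀N hq₀p Dt β ι u hmin n₀ hn₀ hn₀K d₀ hd₀ m'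
  have hp : p.Prime := Fact.out
  have hD : NumberField.discr K < -4 := KolyvaginAssembly.discr_lt_neg_four hK ⟨hD3, hD4⟩
  haveI : ∀ j : ℕ, NumberField (ringClassField K ι j) := numberField_ringClassField K hK ι
  obtain ⟨τ, hτ⟩ := exists_algEquiv_ne_one_of_isImaginaryQuadratic K hK
  have hττ : τ * τ = 1 := mul_self_eq_one_of_isImaginaryQuadratic hK τ
  -- instances at level `p`
  haveI : NeZero (p ^ 1) := ⟨pow_ne_zero 1 hp.ne_zero⟩
  haveI : Finite (geomTorsion (W.baseChange K) ((p ^ 1 : ℕ) : ℤ)) :=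
    finite_geomTorsion_of_neZero (W.baseChange K) (p ^ 1)
  -- the Poitou–Tate package and a `τ`-equivariant Weil datum at level `p`
  obtain ⟨inv, hperf, hvan, -, hSC, hconj⟩ := hPT K (p ^ 1)
  have h2 : 2 ≤ p ^ 1 := by rw [pow_one]; exact hp.two_le
  obtain ⟨e, hμ, hadd₁, hadd₂, hgal, halt, hnondeg, hτe⟩ := exists_weilDatum_liftAut W τ (p ^ 1) h2
  -- the global intrinsic transverse family at level `p` and its local facts
  obtain ⟨𝒯, h𝒯, -⟩ := Walk.exists_globalTransverseFamily W ι ((p ^ 1 : ℕ) : ℤ)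
  have h𝒯σ' : ∀ (c : ℕ), Squarefree c →
      (∀ q ∈ c.primeFactors, Zhang2014.IsKolyvaginPrime (W.conductorNorm ℤ) W K p q) →
      ∀ (v w : HeightOneSpectrum (𝓞 K)) (h : τ • v = w), v ∈ placesDividing K c →
      ∀ x : galoisCohomology (((W.baseChange K).torsionGaloisModule ((p ^ 1 : ℕ) : ℤ)).toLocal
        (Sum.inr v : Place K)) 1,
      x ∈ 𝒯 (Sum.inr v) → conjActPlace W τ ((p ^ 1 : ℕ) : ℤ) h x ∈ 𝒯 (Sum.inr w) :=
    fun c hc _ v w h hv x hx ↦ Walk.globalTransverse_conjActPlace_mem h𝒯 τ hc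
      (forall_conjActPlace_mem_of_eq_iInf_transverseSubgroup W hK ι τ _ c) v w h hv x hx
  have h𝒯sd' : ∀ (c : ℕ), Squarefree c →
      (∀ q ∈ c.primeFactors, Zhang2014.IsKolyvaginPrime (W.conductorNorm ℤ) W K p q) →
      ∀ v ∈ placesDividing K c,
      inv.dualTransported 𝒯 (weilDualIntertwining (W.baseChange K) (p ^ 1) e hμ hadd₁ hadd₂ hgal)
        (Sum.inr v) = 𝒯 (Sum.inr v) :=
    fun c hc hcK ↦ Walk.globalTransverse_dualTransported_eq (ι := ι) h𝒯 hc
      (fun 𝒯c h𝒯c inv' hperf' w' hw' ↦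
        RingClassTransverse.dualTransported_eq_of_localTransverseFamily W K hK hD ι p hp2 1 le_rfl c hc
          hcK (fun ℓ hℓ ↦ (hcK ℓ hℓ).2.2.2.2.2) 𝒯c h𝒯c e hμ hadd₁ hadd₂ hgal halt hnondeg inv' hperf' w' hw')
      inv hperf
  have hloc' : ∀ ℓ : ℕ, Zhang2014.IsKolyvaginPrime (W.conductorNorm ℤ) W K p ℓ →
      1 ≤ Zhang2014.kolyvaginIndex W p ℓ →
      ∀ (v : HeightOneSpectrum (𝓞 K)), (ℓ : 𝓞 K) ∈ v.asIdeal → ∀ (hfix : τ • v = v) (s : ℤ),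
      (s = 1 ∨ s = -1) →
      ((W.baseChange K).kummerSelmerStructure ((p ^ 1 : ℕ) : ℤ) (Sum.inr v)).relIndex
        ((conjActPlace W τ ((p ^ 1 : ℕ) : ℤ) hfix - s • AddMonoidHom.id _).ker) = p ^ 1 :=
    fun ℓ hℓ hk v hv hfix s hs ↦
      kolyvaginLocalTerm_of_poitouTate hPT W K hK τ hτ p 1 hp2 le_rfl ℓ hℓ hk v hv hfix s hs
  have hdisj' : ∀ ℓ : ℕ, Zhang2014.IsKolyvaginPrime (W.conductorNorm ℤ) W K p ℓ →
      ∀ v : HeightOneSpectrum (𝓞 K), (ℓ : 𝓞 K) ∈ v.asIdeal →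
      Disjoint ((W.baseChange K).kummerSelmerStructure ((p ^ 1 : ℕ) : ℤ) (Sum.inr v)) (𝒯 (Sum.inr v)) :=
    fun ℓ hℓ v hv ↦ Walk.globalTransverse_disjoint_kummer h𝒯
      (P := fun ℓ ↦ Zhang2014.IsKolyvaginPrime (W.conductorNorm ℤ) W K p ℓ)
      (fun ℓ hℓ w hw ↦ Walk.disjoint_kummer_iInf_transverseSubgroup W K hK hD ι 1 hℓ w hw)
      (fun ℓ hℓ ↦ hℓ.1) ℓ hℓ v hv
  -- [GZ86 III (3.1)] (guarded) from F1; McCallum 4.4 from Gross 3.7 (2)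
  obtain ⟨n', hcop', hGZ'⟩ := HeegnerE0ImageFree.forall_hGZ_of_Gross1991_imageFree hF1 W K hK hD3 hD4 hH p hp2 hirr Dt β ι
  exact exists_conductor_levelIndex_ge_of_minDepth_of_pair_of_irreducible W τ p e hμ hadd₁ hadd₂ hgal halt hnondeg hτe hK hD3
    hD4 hH hp2 hirr hHp hneg hq₀ hq₀d hq₀N hq₀p hτ hττ Dt β ι h372p inv hperf hvan hSC (hconj τ)
    𝒯 h𝒯 h𝒯σ' h𝒯sd' hloc' hdisj' hcop' hGZ' hmin hn₀ hn₀K d₀ hd₀ m'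

end Summit.BirchSwinnertonDyer.Rank1Residual.JET.Swap

namespace Summit.BirchSwinnertonDyer.Rank1Residual.X11b.Three.Koly

open WeierstrassCurve IsDedekindDomain NumberField Field Literature.NumberTheory.EllipticCurves
  Literature.NumberTheory.EllipticCurves.ModularForms Literature.NumberTheory.EllipticCurves.Jetchev2008
  Literature.NumberTheory.EllipticCurves.Rank1Residual Literature.NumberTheory.GaloisRepresentations
  Summit.BirchSwinnertonDyer.Rank1Residual Summit.BirchSwinnertonDyer.Rank1Residual.X11b
  Summit.BirchSwinnertonDyer.Rank1Residual.JET Summit.BirchSwinnertonDyer.BirchSwinnertonDyer.Theorems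

/-- **DISPLAY — 19111's `stub_upper3_jetchevMax` ⟸ {(γ)-pair congruence (Gross 3.7 (2) pair form incl. ℓ = 2), Poitou–Tate, GZ III (3.1)
image-free}, NO supply hypothesis, `−1 ∈ ρ̄_{E,3}(Γ_ℚ)` automatic**; see the module docstring. CONDITIONAL; nothing booked; no stub closes.
[cite: Jetchev2008, Thm. 1.4 (p. 812)] [cite: McCallumLMS1991, §4 Prop. 4.4, §5 Prop. 5.2] [cite: GrossLMS1991, Prop. 3.7 (2), §6]
[cite: GrossZagier1986, III (3.1)] [cite: MilneADT2006, Ch. I, Thm. 4.10(b)] -/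
theorem cornerUpper3_jetchevMax_of_namedFacts
    (h372p : ∀ (W : WeierstrassCurve ℚ) [W.IsGloballyMinimal] [NeZero (W.conductorNorm ℤ)]
      (K : Type) [Field K] [NumberField K], Prop44.prop37_2_reductionCongruence_pair W K)
    (hPT : ∀ (K : Type) [Field K] [NumberField K], poitouTate_selmerStructure_duality_conj K)
    (hF1 : Gross1991_heegnerPoint_sub_ratTorsion_mem_E0_imageFree) :
    ∀ (W : WeierstrassCurve ℚ) [W.IsElliptic] [W.IsGloballyMinimal] [NeZero (W.conductorNorm ℤ)]
      (K : Type) [Field K] [NumberField K]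
      (Dt : ModularParametrizationData W (W.conductorNorm ℤ)) (β : ℤ) (ι : K →+* ℂ),
      ClassX11b W 3 → ¬ Surj W 3 →
      IsImaginaryQuadratic K → SatisfiesHeegnerHypothesis (W.conductorNorm ℤ) K →
      Odd (NumberField.discr K) →
      (4 * (W.conductorNorm ℤ : ℤ)) ∣ β ^ 2 - NumberField.discr K → ¬ (3 : ℤ) ∣ Dt.c →
      ∀ (v : HeightOneSpectrum (𝓞 ℚ)) (s : ℕ), s ≤ padicValNat 3 (W.tamagawaNumberAt v) →
        ∀ (n : ℕ) (d : KolyvaginHeegnerData Dt β ι n), Squarefree n →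
          (∀ ℓ ∈ n.primeFactors, Zhang2014.IsKolyvaginPrime (W.conductorNorm ℤ) W K 3 ℓ ∧
            s ≤ Zhang2014.kolyvaginIndex W 3 ℓ) → PDiv d 3 s := by
  haveI : Fact (Nat.Prime 3) := ⟨Nat.prime_three⟩
  refine cornerUpper3_jetchevMax_of_swap_of_perLevel' ?_
    (hlevThree_of_pair_of_selmerSupply h372p (selmerSupplyCornerThree_of_poitouTate_Gross1991 hPT hF1))
  intro W _ _ _ K _ _ Dt β ι hX hns hK' hHN hodd hβ hc M e n d hsq hnK hall hnd
  have hp2 : (3 : ℕ) ≠ 2 := by decide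
  have hirr : W.HasIrreducibleModPGaloisRep 3 := hX.2.2.2
  have h3N : 3 ∣ W.conductorNorm ℤ := dvd_conductorNorm_of_mult hX.2.2.1
  have hHp : SatisfiesHeegnerHypothesis 3 K := hHN.of_dvd h3N
  have h3d : ¬ (3 : ℤ) ∣ NumberField.discr K := by
    exact_mod_cast Literature.SatisfiesHeegnerHypothesis.not_dvd_discr hK'.1 hHN Nat.prime_three h3N
  have hd : 4 < (NumberField.discr K).natAbs := four_lt_natAbs_discr_of_odd hK'.1 hodd h3d
  have hDneg : NumberField.discr K < 0 := (isImaginaryQuadratic_iff_discr_neg.1 hK').2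
  have hD3 : NumberField.discr K ≠ -3 := by omega
  have hD4 : NumberField.discr K ≠ -4 := by omega
  obtain ⟨q₀, hq₀, hq₀d, hq₀N, hq₀p⟩ := exists_prime_dvd_discr_of_heegner hK'.1 hd hHN hHp
  have hneg : ∃ γ : Field.absoluteGaloisGroup ℚ, ∀ P : geomTorsion W 3, γ • P = -P := by
    obtain ⟨γ, hγ⟩ := ShimuraKolyvaginMinusOneSquare.exists_sq_smul_eq_neg_three_of_irr W hirr
    exact ⟨γ * γ, fun P ↦ by rw [mul_smul]; exact hγ P⟩
  haveI : ∀ j : ℕ, NumberField (ringClassField K ι j) := numberField_ringClassField K hK' ι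
  have hidx : ∀ {c : ℕ}, (∀ q ∈ c.primeFactors, Zhang2014.IsKolyvaginPrime (W.conductorNorm ℤ) W K 3 q ∧
      1 + M ≤ Zhang2014.kolyvaginIndex W 3 q) → ∀ q ∈ c.primeFactors,
      Zhang2014.IsKolyvaginPrime (W.conductorNorm ℤ) W K 3 q ∧ M + 1 ≤ Zhang2014.kolyvaginIndex W 3 q :=
    fun h q hq ↦ ⟨(h q hq).1, by rw [Nat.add_comm]; exact (h q hq).2⟩
  obtain ⟨n', d', hn', hn'K, hnd'⟩ := Swap.levelRaising_of_pair_of_irreducible hPT hF1 W K hK' hD3 hD4 hHN (h372p W K) 3 hp2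
    hirr hHp hneg hq₀ hq₀d hq₀N hq₀p Dt β ι M (fun c hc hcK dc ↦ hall c dc hc (hidx hcK)) n hsq
    (fun q hq ↦ ⟨(hnK q hq).1, by rw [Nat.add_comm]; exact (hnK q hq).2⟩) d hnd e
  exact ⟨n', d', hn', fun q hq ↦ ⟨(hn'K q hq).1, le_trans (le_max_left _ _) (hn'K q hq).2⟩, hnd'⟩

end Summit.BirchSwinnertonDyer.Rank1Residual.X11b.Three.Koly

end
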